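/- Free-seat work of EXTRA WIDTH SEAT `ym-line-cbag-p1-w5` (prover-ym-line-cbag-p1-w5-g2-0), route `EguchiKawaiDirectionLadder`
(ideator ym-idea-2, LINE 8), crux `TripleSmallBallMargin` (stmt-QuantumFields-27724), LEAD g24's v7 architecture, STUB S6 (GrNet):
an `N`-UNIFORM NET OF THE GRASSMANNIAN `Gr(r, r+s) = {U·P₀·U⋆ : U ∈ U(r+s)}` in operator norm, of size `≤ 33^{N²} ρ^{−2rs}`
(`2rs = dim_ℝ Gr`), built from the tree's two-sided Haar small-ball bounds for `U(n)` alone (`haar_unitaryOpBall_ge`,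
`exists_separated_net`, `one_le_card_net_mul_pow` of `UnitaryHaarSmallBall(Upper)`) — the entropy input of the rank-robust rigidity
primitives (S7/S8) where the margin `e > 3/4` of the crux lives.  Route-independent.  Nothing here bears on the Yang–Mills mass gap
(barrier-ledger line onto `EguchiKawaiBreakdown`). -/
import Summits.QuantumFields.YangMills.Theorems.EguchiKawaiDirectionLadderGrassmannianNetGrid

/-!
# Route `EguchiKawaiDirectionLadder`, stub S6: a Grassmannian net from operator-ball bounds

`exists_grassmannian_net`: for `N = r + s` and `0 < ρ ≤ 1` there is a finite `𝒩 ⊆ U(N)` with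
`#𝒩 ≤ 33^{N²} · ρ^{−2rs}` such that every conjugate `U·P₀·U⋆` of the coordinate projection `P₀ = headProj r s` is within `ρ`
(ℓ²-operator norm) of `V·P₀·V⋆` for some `V ∈ 𝒩`.

Proof (Szarek-type packing, with the tree's tools only; part 1 = `…GrassmannianNetGrid.lean`).  Let `δ = ρ/4`.
* GRID IN THE STABILISER: `2δ`-separated nets `P_r ⊆ U(r)`, `P_s ⊆ U(s)` have `#P_r ≥ (3δ)^{−r²}`, `#P_s ≥ (3δ)^{−s²}`; the
  block-diagonal grid `blockDiag₂(P_r × P_s) ⊆ U(N)` is `2δ`-separated, so the `δ`-balls around `V·grid` are disjoint and their union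
  `G(V)` has Haar measure `≥ #P_r #P_s (δ/(2π+δ))^{N²}`.
* PACKING (`card_mul_grid_le_one`): `G(V) ⊆ {U : ‖UP₀U⋆ − VP₀V⋆‖ ≤ 2δ}`; so for a family `Vs` with pairwise
  `‖V P₀ V⋆ − V' P₀ V'⋆‖ > 4δ = ρ` the `G(V)` are disjoint and `#Vs ≤ 1/μ(G) ≤ (3δ)^{r²+s²}((2π+δ)/δ)^{N²} ≤ 33^{N²} ρ^{−2rs}`
  (`net_constant_le`; `r² + s² − N² = −2rs`).
* NET: a `ρ`-separated family of maximal cardinality exists (the bound) and is a `ρ`-net by maximality.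
-/

set_option autoImplicit false

noncomputable section

open MeasureTheory
open scoped Matrix Matrix.Norms.L2Operator ENNReal Real
open Literature.Barriers.QuantumFields

namespace Summit.QuantumFields.YangMills.Theorems.EguchiKawaiDirectionLadder

namespace GrNet

/-! ### Packing in the Grassmannian pseudo-metric and the net -/

section Net

variable {r s : ℕ}

/-- **Packing**: if the conjugates `V P₀ V⋆`, `V ∈ Vs`, are pairwise more than `4δ` apart, the translated grids `G(V)` are pairwise
disjoint, whence `#Vs · #P_r · #P_s · (δ/(2π+δ))^{N²} ≤ 1`. -/
theorem card_mul_grid_le_one {δ : ℝ} (hδ : 0 < δ)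
    {Pr : Finset (Matrix.unitaryGroup (Fin r) ℂ)} {Ps : Finset (Matrix.unitaryGroup (Fin s) ℂ)}
    (hPr : ∀ g ∈ Pr, ∀ g' ∈ Pr, g ≠ g' → 2 * δ < ‖(g : Matrix (Fin r) (Fin r) ℂ) - (g' : Matrix (Fin r) (Fin r) ℂ)‖)
    (hPs : ∀ g ∈ Ps, ∀ g' ∈ Ps, g ≠ g' → 2 * δ < ‖(g : Matrix (Fin s) (Fin s) ℂ) - (g' : Matrix (Fin s) (Fin s) ℂ)‖)
    (Vs : Finset (Matrix.unitaryGroup (Fin (r + s)) ℂ))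
    (hsep : ∀ V ∈ Vs, ∀ V' ∈ Vs, V ≠ V' → 4 * δ <
      ‖(V : Matrix (Fin (r + s)) (Fin (r + s)) ℂ) * headProj r s * (V : Matrix (Fin (r + s)) (Fin (r + s)) ℂ)ᴴ -
        (V' : Matrix (Fin (r + s)) (Fin (r + s)) ℂ) * headProj r s * (V' : Matrix (Fin (r + s)) (Fin (r + s)) ℂ)ᴴ‖) :
    (Vs.card : ℝ≥0∞) * ((Pr.card : ℝ≥0∞) * Ps.card * ENNReal.ofReal ((δ / (2 * π + δ)) ^ ((r + s) * (r + s)))) ≤ 1 := by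
  haveI := isMulLeftInvariant_haar (r + s)
  set μ := Literature.MathematicalPhysics.QuantumFieldTheory.haarProbability (Matrix.unitaryGroup (Fin (r + s)) ℂ) with hμ
  set G : Matrix.unitaryGroup (Fin (r + s)) ℂ → Set (Matrix.unitaryGroup (Fin (r + s)) ℂ) := fun V =>
    ⋃ p ∈ Pr ×ˢ Ps, (fun W => (V * blockDiag₂ p.1 p.2)⁻¹ * W) ⁻¹' unitaryOpBall (r + s) δ with hG
  have hGmeas : ∀ V, MeasurableSet (G V) := fun V =>
    MeasurableSet.biUnion (Finset.countable_toSet _) fun p _ =>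
      (measurableSet_unitaryOpBall δ).preimage (measurable_const_mul _)
  have hGdisj : (Vs : Set (Matrix.unitaryGroup (Fin (r + s)) ℂ)).PairwiseDisjoint G := by
    intro V hV V' hV' hne
    rw [Function.onFun, Set.disjoint_left]
    intro U hU hU'
    have h1 := grid_subset_conjBall V δ Pr Ps hU
    have h2 := grid_subset_conjBall V' δ Pr Ps hU'
    simp only [Set.mem_setOf_eq] at h1 h2
    have h3 : ‖(V : Matrix (Fin (r + s)) (Fin (r + s)) ℂ) * headProj r s * (V : Matrix (Fin (r + s)) (Fin (r + s)) ℂ)ᴴ -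
        (V' : Matrix (Fin (r + s)) (Fin (r + s)) ℂ) * headProj r s * (V' : Matrix (Fin (r + s)) (Fin (r + s)) ℂ)ᴴ‖ ≤ 4 * δ := by
      calc _ = ‖((V : Matrix (Fin (r + s)) (Fin (r + s)) ℂ) * headProj r s * (V : Matrix (Fin (r + s)) (Fin (r + s)) ℂ)ᴴ -
              (U : Matrix (Fin (r + s)) (Fin (r + s)) ℂ) * headProj r s * (U : Matrix (Fin (r + s)) (Fin (r + s)) ℂ)ᴴ) +
            ((U : Matrix (Fin (r + s)) (Fin (r + s)) ℂ) * headProj r s * (U : Matrix (Fin (r + s)) (Fin (r + s)) ℂ)ᴴ -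
              (V' : Matrix (Fin (r + s)) (Fin (r + s)) ℂ) * headProj r s * (V' : Matrix (Fin (r + s)) (Fin (r + s)) ℂ)ᴴ)‖ := by
            rw [sub_add_sub_cancel]
        _ ≤ 2 * δ + 2 * δ := (norm_add_le _ _).trans (add_le_add (by rw [norm_sub_rev]; exact h1) h2)
        _ = 4 * δ := by ring
    exact absurd (hsep V hV V' hV' hne) (not_lt.2 h3)
  have hGge : ∀ V ∈ Vs, (Pr.card : ℝ≥0∞) * Ps.card * ENNReal.ofReal ((δ / (2 * π + δ)) ^ ((r + s) * (r + s))) ≤ μ (G V) :=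
    fun V _ => measure_grid_ge V hδ hPr hPs
  calc (Vs.card : ℝ≥0∞) * ((Pr.card : ℝ≥0∞) * Ps.card * ENNReal.ofReal ((δ / (2 * π + δ)) ^ ((r + s) * (r + s))))
      = ∑ _V ∈ Vs, (Pr.card : ℝ≥0∞) * Ps.card * ENNReal.ofReal ((δ / (2 * π + δ)) ^ ((r + s) * (r + s))) := by
        rw [Finset.sum_const, nsmul_eq_mul]
    _ ≤ ∑ V ∈ Vs, μ (G V) := Finset.sum_le_sum hGge
    _ = μ (⋃ V ∈ Vs, G V) := (measure_biUnion_finset hGdisj (fun V _ => hGmeas V)).symm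
    _ ≤ μ Set.univ := measure_mono (Set.subset_univ _)
    _ = 1 := measure_univ

/-- The constants: `(3δ)^{r²}(3δ)^{s²}((2π+δ)/δ)^{(r+s)²} ≤ 33^{(r+s)²} ρ^{−2rs}` for `δ = ρ/4`, `0 < ρ ≤ 1`. -/
theorem net_constant_le (r s : ℕ) {ρ : ℝ} (hρ : 0 < ρ) (hρ1 : ρ ≤ 1) :
    (3 * (ρ / 4)) ^ (r * r) * (3 * (ρ / 4)) ^ (s * s) * ((2 * π + ρ / 4) / (ρ / 4)) ^ ((r + s) * (r + s)) ≤
      (33 : ℝ) ^ ((r + s) * (r + s)) * ρ⁻¹ ^ (2 * r * s) := by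
  have hπ : π ≤ 4 := Real.pi_le_four
  have hδ : 0 < ρ / 4 := by positivity
  -- (2π + ρ/4)/(ρ/4) ≤ 33/ρ
  have h1 : (2 * π + ρ / 4) / (ρ / 4) ≤ 33 * ρ⁻¹ := by
    rw [div_le_iff₀ hδ]
    have : 33 * ρ⁻¹ * (ρ / 4) = 33 / 4 := by field_simp
    rw [this]; linarith
  -- (3ρ/4)^k ≤ ρ^k
  have h2 : ∀ k : ℕ, (3 * (ρ / 4)) ^ k ≤ ρ ^ k := fun k =>
    pow_le_pow_left₀ (by positivity) (by linarith) k
  have h3 : ((2 * π + ρ / 4) / (ρ / 4)) ^ ((r + s) * (r + s)) ≤ (33 * ρ⁻¹) ^ ((r + s) * (r + s)) :=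
    pow_le_pow_left₀ (by positivity) h1 _
  have hN : (r + s) * (r + s) = (r * r + s * s) + 2 * r * s := by ring
  calc (3 * (ρ / 4)) ^ (r * r) * (3 * (ρ / 4)) ^ (s * s) * ((2 * π + ρ / 4) / (ρ / 4)) ^ ((r + s) * (r + s))
      ≤ ρ ^ (r * r) * ρ ^ (s * s) * (33 * ρ⁻¹) ^ ((r + s) * (r + s)) :=
        mul_le_mul (mul_le_mul (h2 _) (h2 _) (by positivity) (by positivity)) h3 (by positivity) (by positivity)
    _ = (33 : ℝ) ^ ((r + s) * (r + s)) * (ρ ^ (r * r + s * s) * ρ⁻¹ ^ (r * r + s * s)) * ρ⁻¹ ^ (2 * r * s) := by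
        rw [mul_pow, hN, pow_add, pow_add]; ring
    _ = (33 : ℝ) ^ ((r + s) * (r + s)) * ρ⁻¹ ^ (2 * r * s) := by
        rw [← mul_pow, mul_inv_cancel₀ hρ.ne', one_pow, mul_one]

/-- **Cardinality of a `ρ`-separated family of conjugates** (`0 < ρ ≤ 1`): at most `33^{N²} ρ^{−2rs}`. -/
theorem card_le_of_conjSeparated {ρ : ℝ} (hρ : 0 < ρ) (hρ1 : ρ ≤ 1)
    (Vs : Finset (Matrix.unitaryGroup (Fin (r + s)) ℂ))
    (hsep : ∀ V ∈ Vs, ∀ V' ∈ Vs, V ≠ V' → ρ <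
      ‖(V : Matrix (Fin (r + s)) (Fin (r + s)) ℂ) * headProj r s * (V : Matrix (Fin (r + s)) (Fin (r + s)) ℂ)ᴴ -
        (V' : Matrix (Fin (r + s)) (Fin (r + s)) ℂ) * headProj r s * (V' : Matrix (Fin (r + s)) (Fin (r + s)) ℂ)ᴴ‖) :
    (Vs.card : ℝ) ≤ (33 : ℝ) ^ ((r + s) * (r + s)) * ρ⁻¹ ^ (2 * r * s) := by
  set δ : ℝ := ρ / 4 with hδdef
  have hδ : 0 < δ := by positivity
  obtain ⟨Pr, hPr, hPr1⟩ := exists_separated_card_ge r hδ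
  obtain ⟨Ps, hPs, hPs1⟩ := exists_separated_card_ge s hδ
  have hsep' : ∀ V ∈ Vs, ∀ V' ∈ Vs, V ≠ V' → 4 * δ <
      ‖(V : Matrix (Fin (r + s)) (Fin (r + s)) ℂ) * headProj r s * (V : Matrix (Fin (r + s)) (Fin (r + s)) ℂ)ᴴ -
        (V' : Matrix (Fin (r + s)) (Fin (r + s)) ℂ) * headProj r s * (V' : Matrix (Fin (r + s)) (Fin (r + s)) ℂ)ᴴ‖ := by
    intro V hV V' hV' hne
    have : 4 * δ = ρ := by rw [hδdef]; ring
    rw [this]; exact hsep V hV V' hV' hne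
  have hpack := card_mul_grid_le_one hδ hPr hPs Vs hsep'
  set q : ℝ := (δ / (2 * π + δ)) ^ ((r + s) * (r + s)) with hq
  have hqpos : 0 < q := by positivity
  -- to ℝ
  have hreal : (Vs.card : ℝ) * ((Pr.card : ℝ) * Ps.card * q) ≤ 1 := by
    have h : ENNReal.ofReal ((Vs.card : ℝ) * ((Pr.card : ℝ) * Ps.card * q)) ≤ ENNReal.ofReal 1 := by
      rw [ENNReal.ofReal_mul (Nat.cast_nonneg _), ENNReal.ofReal_mul (by positivity),
        ENNReal.ofReal_mul (by positivity), ENNReal.ofReal_natCast, ENNReal.ofReal_natCast, ENNReal.ofReal_natCast,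
        ENNReal.ofReal_one]
      exact hpack
    exact (ENNReal.ofReal_le_ofReal_iff zero_le_one).1 h
  have hVs0 : (0 : ℝ) ≤ Vs.card := Nat.cast_nonneg _
  -- #Vs ≤ #Vs · (#P_r (3δ)^{r²}) · (#P_s (3δ)^{s²}) = [#Vs #P_r #P_s q] · (3δ)^{r²} (3δ)^{s²} / q ≤ (3δ)^{r²}(3δ)^{s²}/q
  have hstep : (Vs.card : ℝ) ≤ (3 * δ) ^ (r * r) * (3 * δ) ^ (s * s) * ((2 * π + δ) / δ) ^ ((r + s) * (r + s)) := by
    have hinvq : ((2 * π + δ) / δ) ^ ((r + s) * (r + s)) = q⁻¹ := by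
      rw [hq, ← inv_pow, inv_div]
    rw [hinvq]
    have h1 : (Vs.card : ℝ) ≤ (Vs.card : ℝ) * ((Pr.card : ℝ) * (3 * δ) ^ (r * r)) * ((Ps.card : ℝ) * (3 * δ) ^ (s * s)) := by
      have := mul_le_mul hPr1 hPs1 zero_le_one (by positivity)
      rw [one_mul] at this
      calc (Vs.card : ℝ) = (Vs.card : ℝ) * 1 := (mul_one _).symm
        _ ≤ (Vs.card : ℝ) * (((Pr.card : ℝ) * (3 * δ) ^ (r * r)) * ((Ps.card : ℝ) * (3 * δ) ^ (s * s))) :=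
            mul_le_mul_of_nonneg_left this hVs0
        _ = _ := by ring
    have h2 : (Vs.card : ℝ) * ((Pr.card : ℝ) * (3 * δ) ^ (r * r)) * ((Ps.card : ℝ) * (3 * δ) ^ (s * s)) =
        ((Vs.card : ℝ) * ((Pr.card : ℝ) * Ps.card * q)) * ((3 * δ) ^ (r * r) * (3 * δ) ^ (s * s) * q⁻¹) := by
      field_simp
    rw [h2] at h1
    calc (Vs.card : ℝ) ≤ ((Vs.card : ℝ) * ((Pr.card : ℝ) * Ps.card * q)) * ((3 * δ) ^ (r * r) * (3 * δ) ^ (s * s) * q⁻¹) := h1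
      _ ≤ 1 * ((3 * δ) ^ (r * r) * (3 * δ) ^ (s * s) * q⁻¹) := mul_le_mul_of_nonneg_right hreal (by positivity)
      _ = _ := one_mul _
  exact hstep.trans (net_constant_le r s hρ hρ1)

/-- **Grassmannian net from operator-ball bounds (stub S6 of the v7 architecture of stmt-QuantumFields-27724).**  For `N = r + s`
and `0 < ρ ≤ 1` there is a finite `𝒩 ⊆ U(N)` with `#𝒩 ≤ 33^{N²} · ρ^{−2rs}` (`2rs = dim_ℝ Gr(r, N)`; all constants absolute, i.e.
`e^{O(N²)}`-uniform) such that every conjugate `U P₀ U⋆` of the rank-`r` coordinate projection `P₀ = headProj r s` is within `ρ` in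
ℓ²-operator norm of `V P₀ V⋆` for some `V ∈ 𝒩`.  Built from the tree's Haar small-ball bounds for `U(n)` only (no Riemannian volume of the
flag manifold, no Weyl integration). -/
theorem exists_grassmannian_net (r s : ℕ) {ρ : ℝ} (hρ : 0 < ρ) (hρ1 : ρ ≤ 1) :
    ∃ 𝒩 : Finset (Matrix.unitaryGroup (Fin (r + s)) ℂ),
      (𝒩.card : ℝ) ≤ (33 : ℝ) ^ ((r + s) * (r + s)) * ρ⁻¹ ^ (2 * r * s) ∧
      ∀ U : Matrix.unitaryGroup (Fin (r + s)) ℂ, ∃ V ∈ 𝒩,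
        ‖(U : Matrix (Fin (r + s)) (Fin (r + s)) ℂ) * headProj r s * (U : Matrix (Fin (r + s)) (Fin (r + s)) ℂ)ᴴ -
          (V : Matrix (Fin (r + s)) (Fin (r + s)) ℂ) * headProj r s * (V : Matrix (Fin (r + s)) (Fin (r + s)) ℂ)ᴴ‖ ≤ ρ := by
  classical
  -- conjugation-separated families
  let good : Finset (Matrix.unitaryGroup (Fin (r + s)) ℂ) → Prop := fun Vs =>
    ∀ V ∈ Vs, ∀ V' ∈ Vs, V ≠ V' → ρ <
      ‖(V : Matrix (Fin (r + s)) (Fin (r + s)) ℂ) * headProj r s * (V : Matrix (Fin (r + s)) (Fin (r + s)) ℂ)ᴴ -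
        (V' : Matrix (Fin (r + s)) (Fin (r + s)) ℂ) * headProj r s * (V' : Matrix (Fin (r + s)) (Fin (r + s)) ℂ)ᴴ‖
  let Pk : ℕ → Prop := fun k => ∃ Vs, good Vs ∧ Vs.card = k
  set Bnd : ℝ := (33 : ℝ) ^ ((r + s) * (r + s)) * ρ⁻¹ ^ (2 * r * s) with hBnd
  set Bd : ℕ := ⌊Bnd⌋₊ with hBd
  have hcard : ∀ Vs, good Vs → (Vs.card : ℝ) ≤ Bnd := fun Vs hVs => card_le_of_conjSeparated hρ hρ1 Vs hVs
  have hcardN : ∀ Vs, good Vs → Vs.card ≤ Bd := fun Vs hVs => Nat.le_floor (hcard Vs hVs)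
  have hP0 : Pk 0 := ⟨∅, by simp [good], rfl⟩
  set k₀ := Nat.findGreatest Pk Bd with hk₀
  obtain ⟨Vs₀, hgood, hcardVs₀⟩ : Pk k₀ := Nat.findGreatest_spec (Nat.zero_le Bd) hP0
  refine ⟨Vs₀, hcard Vs₀ hgood, fun U => ?_⟩
  by_contra hcon
  push Not at hcon
  have hU : U ∉ Vs₀ := by
    intro hU
    have := hcon U hU
    rw [sub_self, norm_zero] at this
    linarith
  have hgood' : good (insert U Vs₀) := by
    intro a ha b hb hab
    rw [Finset.mem_insert] at ha hb
    rcases ha with ha | ha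
    · rcases hb with hb | hb
      · exact absurd (ha.trans hb.symm) hab
      · rw [ha]; exact hcon b hb
    · rcases hb with hb | hb
      · rw [hb, norm_sub_rev]; exact hcon a ha
      · exact hgood a ha b hb hab
  have hP1 : Pk (k₀ + 1) := ⟨insert U Vs₀, hgood', by rw [Finset.card_insert_of_notMem hU, hcardVs₀]⟩
  have hle : k₀ + 1 ≤ Bd := by
    have := hcardN _ hgood'
    rwa [Finset.card_insert_of_notMem hU, hcardVs₀] at this
  exact Nat.findGreatest_is_greatest (Nat.lt_succ_self k₀) hle hP1

end Net

end GrNet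

end Summit.QuantumFields.YangMills.Theorems.EguchiKawaiDirectionLadder

end
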